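import Mathlib
import HarnessLib.Audit
import Summits.PneNP.PneNP.Theorems.ClusUniversalCertificateCubeA

/-!
# Route ClusUniversalCertificate — the nonlinear Lemma Z: sublevel sets of a triangular predictor are interpolation sets
(rung F-N1, cell pnp-ideate, crux `UniversalCertAll` = stmt-PneNP-19683; planner p1 g13, `HOME/pnp-ideate-p1/lines/hilbert-TII.md` §2
Lemma 5 / Corollary 6, task §6 T1; restricted-model combinatorics — nothing here bears on `P` versus `NP`)

Tools for `ClusHilbertBound` (the kernel proof of p1's TII inequality).  Points `V N = Fin N → 𝔽₂` (`ClusCube.V`, p1's `V N`); functions `V N → 𝔽₂`.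

* `chi S` — the multilinear monomial function `x_S = ∏_{i∈S} x_i`; `Pdeg K d` — the span of the `x_S` with `S ⊆ K`, `#S ≤ d` (functions of
  degree `≤ d` in the variables `K`); `pref N k` — the first `k` coordinates.  Splitting off a coordinate `j`: `setC j b f = f(x with x_j := b)`;
  for `f ∈ Pdeg (pref (k+1)) d`, `f(·, x_k := 0) ∈ Pdeg (pref k) d` and `f(·,1) − f(·,0) ∈ Pdeg (pref k) (d−1)` (`= 0` when `d = 0`).
* A TRIANGULAR PREDICTOR `g : (t : Fin N) → (Fin t → 𝔽₂) → 𝔽₂` predicts bit `t` from the earlier bits; `predErr g y` (p1's definition,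
  verbatim) counts the coordinates it gets wrong on `y` — the weight `|φ(y)|` of the triangular bijection `φ(y)_t = y_t + g_t(y_{<t})`;
  `errLT k g y` counts the errors among the first `k` coordinates.
* **`eq_zero_of_vanish_on_sublevel` (nonlinear Lemma Z, hilbert-TII.md Lemma 5).**  A function of degree `≤ d` vanishing on the sublevel set
  `{y : predErr g y ≤ d}` vanishes identically.  Proof inside the fixed cube by induction on the prefix length `k` (`lemmaZ_prefix`): split
  `f = p₀ + x_k p₁`; both `y[x_k := 0]` and `y[x_k := 1]` lie in the sublevel set when `y` has `≤ d − 1` earlier errors, so `p₁` vanishes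
  there and is `0` by induction (degree `d − 1`); then `f = p₀`, and following the predictor at coordinate `k` costs no error, so `p₀`
  vanishes on `{errLT k ≤ d}` and is `0` by induction.  (The case `g ≡ 0` is `ClusUniversalCertificateCubeA.lemmaZ` up to complementation.)
* `predErr_add_predErr_flip` — the complementary predictor `g + 1` makes exactly the complementary errors: `|φ_g(y)| + |φ_{g+1}(y)| = N`;
* `eval_mem_Pdeg` — the function of an `MvPolynomial` of total degree `≤ d` lies in `Pdeg univ d` (`x_i^e = x_i` on `𝔽₂`-points), the bridge to
  `ClusUniversalCertificateCubeA.flatInd_lowDegree`.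
-/

set_option linter.dupNamespace false -- `Summit.PneNP.PneNP.…`: summit = sub-problem name (D-0017 single-conjunct layout)

namespace Summit.PneNP.PneNP.Theorems.ClusHilbert

open Finset MvPolynomial
open Summit.PneNP.PneNP.Theorems.ClusCube (V)

/-! Points of `𝔽₂^N` are `ClusCube.V N = (Fin N → ZMod 2)` (p1's sketch calls this type `V N`). -/

variable {N : ℕ}

/-- Every element of `ZMod 2` is `0` or `1`. -/
private theorem zmod2_eq_zero_or_one (z : ZMod 2) : z = 0 ∨ z = 1 := by
  fin_cases z
  · exact Or.inl rfl
  · exact Or.inr rfl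

/-! ## Monomial functions and the degree filtration -/

/-- the multilinear monomial function `x_S = ∏_{i ∈ S} x_i` -/
def chi (S : Finset (Fin N)) (x : V N) : ZMod 2 := ∏ i ∈ S, x i

/-- functions of degree `≤ d` in the variables `K`: the span of the monomial functions `x_S`, `S ⊆ K`, `#S ≤ d` -/
def Pdeg (K : Finset (Fin N)) (d : ℕ) : Submodule (ZMod 2) (V N → ZMod 2) :=
  Submodule.span (ZMod 2) {f | ∃ S : Finset (Fin N), S ⊆ K ∧ S.card ≤ d ∧ f = chi S}

/-- the first `k` coordinates of `Fin N` -/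
def pref (N k : ℕ) : Finset (Fin N) := univ.filter fun i => i.val < k

/-- Monomials of the right shape lie in the filtration. -/
theorem chi_mem_Pdeg {K S : Finset (Fin N)} {d : ℕ} (hS : S ⊆ K) (hc : S.card ≤ d) : chi S ∈ Pdeg K d :=
  Submodule.subset_span ⟨S, hS, hc, rfl⟩

/-- All `N` coordinates form the whole index set. -/
theorem pref_self : pref N N = (univ : Finset (Fin N)) :=
  filter_true_of_mem fun i _ => i.isLt

/-- Setting a coordinate outside `S` does not change `x_S`. -/
theorem chi_update_of_not_mem {S : Finset (Fin N)} {j : Fin N} (hj : j ∉ S) (x : V N) (b : ZMod 2) :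
    chi S (Function.update x j b) = chi S x := by
  unfold chi
  refine prod_congr rfl fun i hi => ?_
  rw [Function.update_of_ne (ne_of_mem_of_not_mem hi hj)]

/-- Setting a coordinate of `S` to `0` kills `x_S`. -/
theorem chi_update_zero_of_mem {S : Finset (Fin N)} {j : Fin N} (hj : j ∈ S) (x : V N) :
    chi S (Function.update x j 0) = 0 := by
  unfold chi
  exact prod_eq_zero hj (by rw [Function.update_self])

/-- Setting a coordinate of `S` to `1` removes it from `x_S`. -/
theorem chi_update_one_of_mem {S : Finset (Fin N)} {j : Fin N} (hj : j ∈ S) (x : V N) :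
    chi S (Function.update x j 1) = chi (S.erase j) x := by
  unfold chi
  rw [← mul_prod_erase S (Function.update x j 1) hj, Function.update_self, one_mul]
  refine prod_congr rfl fun i hi => ?_
  rw [Function.update_of_ne (ne_of_mem_erase hi)]

/-- evaluation with coordinate `j` frozen to `b`, a linear map on functions -/
def setC (j : Fin N) (b : ZMod 2) : (V N → ZMod 2) →ₗ[ZMod 2] (V N → ZMod 2) where
  toFun f := fun x => f (Function.update x j b)
  map_add' _ _ := rfl
  map_smul' _ _ := rfl

/-- Unfolding `setC`. -/
@[simp] theorem setC_apply (j : Fin N) (b : ZMod 2) (f : V N → ZMod 2) (x : V N) :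
    setC j b f x = f (Function.update x j b) := rfl

/-- A function of the first `k` variables does not see the later coordinates. -/
theorem setC_eq_self_of_le {k : ℕ} {d : ℕ} {f : V N → ZMod 2} (hf : f ∈ Pdeg (pref N k) d) {j : Fin N} (hj : k ≤ j.val)
    (b : ZMod 2) : setC j b f = f := by
  have key : Pdeg (pref N k) d ≤ LinearMap.ker (setC j b - LinearMap.id) := by
    refine Submodule.span_le.2 ?_
    rintro f ⟨S, hS, -, rfl⟩
    have hjS : j ∉ S := fun h => by
      have := (mem_filter.1 (hS h)).2
      omega
    show setC j b (chi S) - chi S = 0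
    rw [sub_eq_zero]
    funext x
    exact chi_update_of_not_mem hjS x b
  have h := key hf
  rw [LinearMap.mem_ker, LinearMap.sub_apply, LinearMap.id_apply, sub_eq_zero] at h
  exact h

/-- Splitting off coordinate `k`: the part `f(·, x_k := 0)` has the same degree in the earlier variables. -/
theorem setC_zero_mem {k : ℕ} (k' : Fin N) (hk : k'.val = k) {d : ℕ} {f : V N → ZMod 2} (hf : f ∈ Pdeg (pref N (k + 1)) d) :
    setC k' 0 f ∈ Pdeg (pref N k) d := by
  have key : Pdeg (pref N (k + 1)) d ≤ (Pdeg (pref N k) d).comap (setC k' 0) := by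
    refine Submodule.span_le.2 ?_
    rintro f ⟨S, hS, hc, rfl⟩
    show setC k' 0 (chi S) ∈ Pdeg (pref N k) d
    by_cases hj : k' ∈ S
    · have h0 : setC k' 0 (chi S) = 0 := by
        funext x; exact chi_update_zero_of_mem hj x
      rw [h0]; exact Submodule.zero_mem _
    · have h1 : setC k' 0 (chi S) = chi S := by
        funext x; exact chi_update_of_not_mem hj x 0
      rw [h1]
      refine chi_mem_Pdeg (fun i hi => ?_) hc
      have h2 := (mem_filter.1 (hS hi)).2
      have h3 : i ≠ k' := fun h => hj (h ▸ hi)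
      have h4 : i.val ≠ k := fun h => h3 (Fin.ext (h.trans hk.symm))
      exact mem_filter.2 ⟨mem_univ _, by omega⟩
  exact key hf

/-- Splitting off coordinate `k`: the slope `f(·, 1) − f(·, 0)` has degree `≤ d − 1` in the earlier variables. -/
theorem setC_one_sub_mem {k : ℕ} (k' : Fin N) (hk : k'.val = k) {d : ℕ} {f : V N → ZMod 2} (hf : f ∈ Pdeg (pref N (k + 1)) d) :
    setC k' 1 f - setC k' 0 f ∈ Pdeg (pref N k) (d - 1) := by
  have key : Pdeg (pref N (k + 1)) d ≤ (Pdeg (pref N k) (d - 1)).comap (setC k' 1 - setC k' 0) := by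
    refine Submodule.span_le.2 ?_
    rintro f ⟨S, hS, hc, rfl⟩
    show setC k' 1 (chi S) - setC k' 0 (chi S) ∈ Pdeg (pref N k) (d - 1)
    by_cases hj : k' ∈ S
    · have h0 : setC k' 1 (chi S) - setC k' 0 (chi S) = chi (S.erase k') := by
        funext x
        show chi S (Function.update x k' 1) - chi S (Function.update x k' 0) = chi (S.erase k') x
        rw [chi_update_one_of_mem hj, chi_update_zero_of_mem hj, sub_zero]
      rw [h0]
      refine chi_mem_Pdeg (fun i hi => ?_) ?_
      · have h2 := (mem_filter.1 (hS (mem_of_mem_erase hi))).2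
        have h3 : i ≠ k' := ne_of_mem_erase hi
        have h4 : i.val ≠ k := fun h => h3 (Fin.ext (h.trans hk.symm))
        exact mem_filter.2 ⟨mem_univ _, by omega⟩
      · have := card_erase_of_mem hj
        have hpos := card_pos.2 ⟨k', hj⟩
        omega
    · have h1 : setC k' 1 (chi S) - setC k' 0 (chi S) = 0 := by
        funext x
        show chi S (Function.update x k' 1) - chi S (Function.update x k' 0) = 0
        rw [chi_update_of_not_mem hj, chi_update_of_not_mem hj, sub_self]
      rw [h1]; exact Submodule.zero_mem _
  exact key hf

/-- In degree `0` the slope vanishes: a degree-`0` function is constant in every coordinate. -/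
theorem setC_one_eq_setC_zero_of_deg_zero {K : Finset (Fin N)} {f : V N → ZMod 2} (hf : f ∈ Pdeg K 0) (j : Fin N) :
    setC j 1 f = setC j 0 f := by
  have key : Pdeg K 0 ≤ LinearMap.ker (setC j 1 - setC j 0) := by
    refine Submodule.span_le.2 ?_
    rintro f ⟨S, -, hc, rfl⟩
    have hS : S = ∅ := card_eq_zero.1 (Nat.le_zero.1 hc)
    show setC j 1 (chi S) - setC j 0 (chi S) = 0
    funext x
    show chi S (Function.update x j 1) - chi S (Function.update x j 0) = 0
    rw [hS]; simp [chi]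
  have h := key hf
  rw [LinearMap.mem_ker, LinearMap.sub_apply, sub_eq_zero] at h
  exact h

/-! ## Triangular predictors -/

/-- the prefix of `y` below coordinate `t` -/
def pre (y : V N) (t : Fin N) : Fin t → ZMod 2 := fun i => y (Fin.castLT i (lt_trans i.isLt t.isLt))

/-- number of coordinates at which the triangular predictor `g` (bit `t` predicted from the bits `< t`) is wrong on `y`; `y ↦ (y_t + g_t(y_{<t}))_t`
is the triangular bijection `φ` of hilbert-TII.md §2 and this is `|φ(y)|` (p1's definition, verbatim) -/
def predErr (g : (t : Fin N) → (Fin t → ZMod 2) → ZMod 2) (y : V N) : ℕ :=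
  (Finset.univ.filter fun t : Fin N =>
    y t ≠ g t (fun i => y (Fin.castLT i (lt_trans i.isLt t.isLt)))).card

/-- errors of the predictor among the first `k` coordinates -/
def errLT (k : ℕ) (g : (t : Fin N) → (Fin t → ZMod 2) → ZMod 2) (y : V N) : ℕ :=
  (Finset.univ.filter fun t : Fin N => t.val < k ∧ y t ≠ g t (pre y t)).card

/-- the complementary predictor -/
def flipPred (g : (t : Fin N) → (Fin t → ZMod 2) → ZMod 2) : (t : Fin N) → (Fin t → ZMod 2) → ZMod 2 := fun t u => g t u + 1

/-- The error count is at most `N`. -/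
theorem predErr_le (g : (t : Fin N) → (Fin t → ZMod 2) → ZMod 2) (y : V N) : predErr g y ≤ N := by
  unfold predErr
  exact (card_le_univ _).trans (by simp)

/-- All errors: `errLT N = predErr`. -/
theorem errLT_self (g : (t : Fin N) → (Fin t → ZMod 2) → ZMod 2) (y : V N) : errLT N g y = predErr g y := by
  unfold errLT predErr pre
  congr 1
  exact filter_congr fun t _ => ⟨fun h => h.2, fun h => ⟨t.isLt, h⟩⟩

/-- No coordinates, no errors. -/
theorem errLT_zero (g : (t : Fin N) → (Fin t → ZMod 2) → ZMod 2) (y : V N) : errLT 0 g y = 0 := by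
  unfold errLT
  rw [card_eq_zero]
  exact filter_eq_empty_iff.2 fun t _ h => Nat.not_lt_zero _ h.1

/-- The prefix below `t` does not see coordinates `≥ t`. -/
theorem pre_update_of_le {y : V N} {j t : Fin N} (h : t ≤ j) (b : ZMod 2) : pre (Function.update y j b) t = pre y t := by
  funext i
  simp only [pre]
  rw [Function.update_of_ne]
  intro heq
  have h1 : (Fin.castLT i (lt_trans i.isLt t.isLt) : Fin N).val = j.val := by rw [heq]
  have h2 : (Fin.castLT i (lt_trans i.isLt t.isLt) : Fin N).val = i.val := rfl
  have h3 := i.isLt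
  have h4 : t.val ≤ j.val := h
  omega

/-- Changing a coordinate `≥ k` does not change the errors among the first `k` coordinates. -/
theorem errLT_update_of_le {k : ℕ} (g : (t : Fin N) → (Fin t → ZMod 2) → ZMod 2) {j : Fin N} (hj : k ≤ j.val) (y : V N)
    (b : ZMod 2) : errLT k g (Function.update y j b) = errLT k g y := by
  unfold errLT
  congr 1
  refine filter_congr fun t _ => ?_
  by_cases ht : t.val < k
  · have htj : t < j := Fin.lt_def.2 (by omega)
    rw [Function.update_of_ne (ne_of_lt htj), pre_update_of_le htj.le]
  · simp only [ht, false_and]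

/-- One more coordinate: `errLT (k+1) = errLT k + [error at k]`. -/
theorem errLT_succ {k : ℕ} (g : (t : Fin N) → (Fin t → ZMod 2) → ZMod 2) (k' : Fin N) (hk : k'.val = k) (y : V N) :
    errLT (k + 1) g y = errLT k g y + (if y k' ≠ g k' (pre y k') then 1 else 0) := by
  classical
  unfold errLT
  have hsplit : (univ.filter fun t : Fin N => t.val < k + 1 ∧ y t ≠ g t (pre y t)) =
      (univ.filter fun t : Fin N => t.val < k ∧ y t ≠ g t (pre y t)) ∪
        (univ.filter fun t : Fin N => t = k' ∧ y t ≠ g t (pre y t)) := by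
    ext t
    simp only [mem_filter, mem_univ, true_and, mem_union]
    constructor
    · rintro ⟨h1, h2⟩
      by_cases h : t.val < k
      · exact Or.inl ⟨h, h2⟩
      · exact Or.inr ⟨Fin.ext (by omega), h2⟩
    · rintro (⟨h1, h2⟩ | ⟨h1, h2⟩)
      · exact ⟨by omega, h2⟩
      · exact ⟨by rw [h1]; omega, h2⟩
  have hdisj : Disjoint (univ.filter fun t : Fin N => t.val < k ∧ y t ≠ g t (pre y t))
      (univ.filter fun t : Fin N => t = k' ∧ y t ≠ g t (pre y t)) := by
    rw [Finset.disjoint_left]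
    intro t h1 h2
    have := (mem_filter.1 h1).2.1
    have h3 := (mem_filter.1 h2).2.1
    rw [h3] at this
    omega
  rw [hsplit, card_union_of_disjoint hdisj]
  congr 1
  by_cases hE : y k' ≠ g k' (pre y k')
  · rw [if_pos hE]
    have : (univ.filter fun t : Fin N => t = k' ∧ y t ≠ g t (pre y t)) = {k'} := by
      ext t
      simp only [mem_filter, mem_univ, true_and, mem_singleton]
      constructor
      · exact fun h => h.1
      · intro h; subst h; exact ⟨rfl, hE⟩
    rw [this, card_singleton]
  · rw [if_neg hE, card_eq_zero]
    refine filter_eq_empty_iff.2 fun t _ h => ?_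
    obtain ⟨h1, h2⟩ := h
    subst h1
    exact hE h2

/-- Complementary predictors make complementary errors: `|φ_g(y)| + |φ_{g+1}(y)| = N`. -/
theorem predErr_add_predErr_flip (g : (t : Fin N) → (Fin t → ZMod 2) → ZMod 2) (y : V N) :
    predErr g y + predErr (flipPred g) y = N := by
  classical
  unfold predErr flipPred
  have e : ∀ a b : ZMod 2, (a ≠ b + 1) ↔ ¬ (a ≠ b) := by decide
  have h : (univ.filter fun t : Fin N => y t ≠ g t (fun i => y (Fin.castLT i (lt_trans i.isLt t.isLt))) + 1) =
      univ.filter fun t : Fin N => ¬ (y t ≠ g t (fun i => y (Fin.castLT i (lt_trans i.isLt t.isLt)))) :=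
    filter_congr fun t _ => e _ _
  rw [h, card_filter_add_card_filter_not, card_univ, Fintype.card_fin]

/-! ## The nonlinear Lemma Z -/

/-- **Lemma Z along a prefix.**  A function of degree `≤ d` in the first `k` variables that vanishes whenever the predictor makes at most `d`
errors among the first `k` coordinates is identically zero. -/
theorem lemmaZ_prefix (g : (t : Fin N) → (Fin t → ZMod 2) → ZMod 2) :
    ∀ k, k ≤ N → ∀ d (f : V N → ZMod 2), f ∈ Pdeg (pref N k) d → (∀ y, errLT k g y ≤ d → f y = 0) → f = 0 := by
  intro k
  induction k with
  | zero =>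
    intro _ d f _ h0
    funext y
    exact h0 y (by rw [errLT_zero]; exact Nat.zero_le _)
  | succ k ih =>
    intro hk d f hf h0
    have hkN : k < N := hk
    set k' : Fin N := ⟨k, hkN⟩ with hk'
    have hkv : k'.val = k := rfl
    -- the slope `p₁` vanishes
    have hp1 : ∀ y, f (Function.update y k' 1) = f (Function.update y k' 0) := by
      rcases Nat.eq_zero_or_pos d with hd | hd
      · subst hd
        intro y
        exact congrFun (setC_one_eq_setC_zero_of_deg_zero hf k') y
      · have hmem := setC_one_sub_mem k' hkv hf
        have hz := ih hkN.le (d - 1) _ hmem fun y hy => ?_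
        · intro y
          have := congrFun hz y
          rw [Pi.sub_apply, setC_apply, setC_apply, Pi.zero_apply] at this
          exact sub_eq_zero.1 this
        · -- both continuations of `y` lie in the sublevel set
          have hboth : ∀ b : ZMod 2, errLT (k + 1) g (Function.update y k' b) ≤ d := by
            intro b
            rw [errLT_succ g k' hkv, errLT_update_of_le g (j := k') hkv.symm.le]
            split_ifs <;> omega
          show f (Function.update y k' 1) - f (Function.update y k' 0) = 0
          rw [h0 _ (hboth 1), h0 _ (hboth 0), sub_zero]
    -- hence `f = p₀`
    have hfp0 : ∀ y, f y = f (Function.update y k' 0) := by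
      intro y
      rcases zmod2_eq_zero_or_one (y k') with h | h
      · conv_lhs => rw [← Function.update_eq_self k' y, h]
      · rw [← hp1]
        conv_lhs => rw [← Function.update_eq_self k' y, h]
    -- `p₀` vanishes on the sublevel set of the first `k` coordinates
    have hp0 : setC k' 0 f = 0 := by
      refine ih hkN.le d _ (setC_zero_mem k' hkv hf) fun y hy => ?_
      show f (Function.update y k' 0) = 0
      -- follow the predictor at coordinate `k`: no new error
      set y' : V N := Function.update y k' (g k' (pre y k')) with hy'
      have hval : errLT (k + 1) g y' ≤ d := by
        rw [errLT_succ g k' hkv, hy', errLT_update_of_le g (j := k') hkv.symm.le, Function.update_self, pre_update_of_le le_rfl,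
          if_neg (fun h => h rfl)]
        omega
      have h1 := h0 y' hval
      rw [hfp0 y', hy', Function.update_idem] at h1
      exact h1
    funext y
    rw [hfp0 y]
    exact congrFun hp0 y

/-- **Nonlinear Lemma Z (hilbert-TII.md Lemma 5).**  A function of degree `≤ d` on `𝔽₂^N` vanishing on the sublevel set
`{y : |φ_g(y)| ≤ d}` of a triangular predictor vanishes identically: the sublevel set is an interpolation set for degree `≤ d`. -/
theorem eq_zero_of_vanish_on_sublevel (g : (t : Fin N) → (Fin t → ZMod 2) → ZMod 2) (d : ℕ) (f : V N → ZMod 2)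
    (hf : f ∈ Pdeg (univ : Finset (Fin N)) d) (h0 : ∀ y, predErr g y ≤ d → f y = 0) : f = 0 :=
  lemmaZ_prefix g N le_rfl d f (by rw [pref_self]; exact hf) fun y hy => h0 y (by rw [← errLT_self]; exact hy)

/-! ## Polynomials of low total degree are functions of low degree -/

/-- The function of an `MvPolynomial` of total degree `≤ d` lies in `Pdeg univ d` (`x_i ^ e = x_i` at `𝔽₂`-points for `e ≥ 1`). -/
theorem eval_mem_Pdeg (P : MvPolynomial (Fin N) (ZMod 2)) {d : ℕ} (hP : P.totalDegree ≤ d) :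
    (fun x : V N => eval x P) ∈ Pdeg (univ : Finset (Fin N)) d := by
  classical
  have hfun : (fun x : V N => eval x P) = ∑ e ∈ P.support, P.coeff e • chi e.support := by
    funext x
    rw [MvPolynomial.eval_eq, Finset.sum_apply]
    refine sum_congr rfl fun e _ => ?_
    rw [Pi.smul_apply, smul_eq_mul, chi]
    congr 1
    refine prod_congr rfl fun i hi => ?_
    have hei : e i ≠ 0 := Finsupp.mem_support_iff.1 hi
    rcases zmod2_eq_zero_or_one (x i) with h | h
    · rw [h, zero_pow hei]
    · rw [h, one_pow]
  rw [hfun]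
  refine Submodule.sum_mem _ fun e he => Submodule.smul_mem _ _ (chi_mem_Pdeg (subset_univ _) ?_)
  exact (ClusCube.card_support_le_degree e).trans ((MvPolynomial.le_totalDegree he).trans hP)

end Summit.PneNP.PneNP.Theorems.ClusHilbert
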